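import Summits.QuantumFields.YangMills.Theorems.LuscherReductionTwistedTraceScalingGaugeSliceKernel
import Summits.QuantumFields.YangMills.Theorems.LuscherReductionTwistedTraceScalingToronOrbit
import Summits.QuantumFields.YangMills.Theorems.LuscherReductionRunningReductionCoarseUpperScales
import HarnessLib

/-!
# R32 — the gauge-averaged kernel `K̃_β = avgKernel β` has NO pointwise LAB one-site slow factor on the core scale `β^{−s}`, `s < 1/2`:
# on constant configurations it is separately `Ad`-invariant, while the LAB one-site kernel `K₁^{L³β}(u,u') = K_β(constLift u, constLift u')` is not
# (crux disprover of `TwistedTraceScaling`, stmt-QuantumFields-20203, cycle 25; `--supports` the crux; negative lane, def-free)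

Lane A's C4-CORE architecture of record (`pub/ym-fleet/ym-luscher-20007-p1/COARSE-DESIGN.md` §23.2 (3), §23.5 (d), §23.7) displays the POINTWISE
factorisation of the bi-invariant kernel `K̃_β(U,V) = ∫ K_β(U, V^g) dg` (`avgKernel`, `…GaugeSliceKernel`) on the tube `T × T` in the equivariant slow chart
`Ψ(u, w, η)` (slow one-site coordinate `u ∈ SU(2)³` with EXACT one-site Haar, LAB-aligned stiff coordinate `w`, gauge coordinate `η` on the vacuum slice):
`K̃_β(Ψ(u,w,η), Ψ(u',w',η')) = 𝒩_g · K₁^{L³β|m||m'|}(u,u') · G_st(w,w') · 1(η,η') · (1 ± η_K)`, «claimed on the kinetic core with (Gaussian) tails, in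
LAB-aligned fibre coordinates», the one-site kinetic term being «exact by `norm_sub_sq_eq_mean_add_fluc`».  At `w = w' = 0`, `η = η' = 0` the chart point is
`Ψ(u,0,0) = constLift u` (`orthoTube u 0`), `|m| = |m'| = 1`, and `K₁^{L³β}(u,u')` IS the un-averaged lattice kernel `K_β(constLift u, constLift u')`
(`transferKernel_constLift`).  THIS FILE shows that no such pointwise LAB factor exists on the core:

* §1 `avgKernel_constLift_conj_left/right`, ★ `avgKernel_constLift_gaugeTransform` — `K̃_β(constLift u, constLift u')` is invariant under INDEPENDENT
  constant conjugations `u ↦ Ad_g u`, `u' ↦ Ad_h u'` (the residual global `SU(2)` of the one-site Gauss law acts on each slot separately);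
* §2 the diagonal flip witness: a Weyl element `W` with `W·diagSU2 θ·W⁻¹ = diagSU2(−θ)` (`exists_weylFlip`); for the constant diagonal configuration
  `u_θ = (diagSU2 θ, diagSU2 θ, diagSU2 θ)`: ★ `avgKernel_constDiag_flip` — `K̃_β(constLift u_θ, constLift u_{−θ}) = K̃_β(constLift u_θ, constLift u_θ)`,
  while ★ `transferKernel_constDiag_flip` — `K_β(constLift u_θ, constLift u_{−θ}) = exp(−β|E|(2 − 2cos 2θ))·K_β(constLift u_θ, constLift u_θ)`
  (exact), with `θ² ≤ 2 − 2cos 2θ` on `[0, π/2]` (`sq_le_two_sub_two_cos_two_mul`);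
* §3 ★★ `exists_flip_pair` — for `0 ≤ s < 1/2` and every `ε > 0`, eventually in `β` there are one-site configurations `u, u' = Ad_W u` INSIDE the core
  (`‖u_k − 1‖_F, ‖u'_k − 1‖_F < β^{−s}` and `orbitDist(constLift u), orbitDist(constLift u') < β^{−s}`) with `K̃_β(constLift u, constLift u') =
  K̃_β(constLift u, constLift u)` but `K_β(constLift u, constLift u') < ε·K_β(constLift u, constLift u)` (`θ_β = β^{−s}/(8L³)`, `βθ_β² = β^{1−2s}/(64L⁶) → ∞`);
* §4 ★★ `not_lab_oneSite_sandwich` — hence there are NO `η < 1`, `𝒩_β > 0` and NO positive `Ad`-invariant one-body factors `a_β(u)` (e.g. functions of `|m|`)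
  with `(1−η)·𝒩_β a_β(u)a_β(u')·K_β(constLift u, constLift u') ≤ K̃_β(constLift u, constLift u') ≤ (1+η)·𝒩_β a_β(u)a_β(u')·K_β(constLift u, constLift u')`
  for all `u, u'` in the core, eventually in `β`; ★★ `not_lab_oneSite_sandwich_const` is the instance `a ≡ 1` (the display (3) at `w = η = 0` verbatim).

READING.  On the core `‖u − 1‖ ≲ β^{−s}` the LAB distance between `u_θ` and its gauge copy `u_{−θ}` is `≍ β^{−s} ≫ (L³β)^{−1/2}` (outside the kinetic core)
— there the design's «Gaussian tails» in the LAB one-site distance are FALSE for `K̃_β`: the averaged kernel is at its diagonal value.  `K̃_β` has tails only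
in the `Ad`-ORBIT distance of `(u, u')`; the slow two-point factor of any pointwise factorisation must be the `Ad`-averaged one-site kernel
`k̃(u,u') = ∫ K₁^{L³β}(u, Ad_g u') dg`, and the slow min–max must run over `Ad`-invariant one-site test functions (one-site `IsPhys`, as the
`levelValue su2Rep 1 (L³β) k` family already does) — as an OPERATOR statement on such functions `K₁` and `k̃` agree, so the repair is cheap; as the
typed pointwise display it is not.  The residual global `SU(2)` (3 dimensions) belongs to the slow one-site problem, not to the vacuum FP slice
`gaugeModes L` (gradients; constants are in its kernel) — the `g₀`-stabiliser caveat of VERDICT 24 (v), now with a kernel-level witness.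
HONEST FRAMING: a no-go for one displayed intermediate identity of lane A's design for stub S-BASE's sub-target C4-CORE of a child of the CONDITIONAL
reduction route R2b1 (`LuscherReduction`); it does not refute `TwistedTraceScaling`, C4, or any registered statement; not a gap, not Clay.

## References
* M. Lüscher, Some analytic results concerning the mass spectrum of Yang–Mills gauge theories on a torus, Nucl. Phys. B219 (1983) 233–261, §3 (the effective
  one-site problem is posed on gauge-INVARIANT wave functions of the constant modes). [Luscher1983]
* E. Seiler, Gauge Theories as a Problem of Constructive Quantum Field Theory and Statistical Mechanics, LNP 159 (1982), §3 (transfer matrix, Gauss law by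
  averaging over the gauge group). [SeilerLNP1982]
-/

set_option autoImplicit false

noncomputable section

open Real
open Literature.MathematicalPhysics.QuantumFieldTheory hiding SU2
open Literature.MathematicalPhysics.QuantumLattice

namespace Summit.QuantumFields.YangMills.Theorems.TwistedTraceScaling.Negative.R32

open Summit.QuantumFields.YangMills.Theorems.FemtoTransferGap
open Summit.QuantumFields.YangMills.Theorems.FemtoTransferGap.TwoLattice.Toron (coe_diagSU2 diagSU2_add diagSU2_neg diagSU2_zero abelianCfg
  orbitDist_abelianCfg_le frobNorm_diagSU2_sub_one_le)
open Summit.QuantumFields.YangMills.Theorems.FemtoTransferGap.TwoLattice.Avg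

variable {L : ℕ} [NeZero L]

/-! ## §1 `K̃_β` on constant configurations is separately `Ad`-invariant -/

/-- `K̃_β(constLift (Ad_g u), V) = K̃_β(constLift u, V)`: a constant conjugation of the one-site datum is a (constant) gauge transformation of the torus
(`gaugeTransform_const_constLift`) and `K̃_β` is left gauge invariant. [cite: SeilerLNP1982, §3] -/
theorem avgKernel_constLift_conj_left (β : ℝ) (g : SU2) (u : GaugeConfig 3 1 SU2) (V : GaugeConfig 3 L SU2) :
    avgKernel β (constLift L (gaugeTransform (fun _ : Site 3 1 => g) u)) V = avgKernel β (constLift L u) V := by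
  rw [← gaugeTransform_const_constLift, avgKernel_gaugeTransform_left]

/-- `K̃_β(U, constLift (Ad_h u')) = K̃_β(U, constLift u')`. [cite: SeilerLNP1982, §3] -/
theorem avgKernel_constLift_conj_right (β : ℝ) (h : SU2) (U : GaugeConfig 3 L SU2) (u' : GaugeConfig 3 1 SU2) :
    avgKernel β U (constLift L (gaugeTransform (fun _ : Site 3 1 => h) u')) = avgKernel β U (constLift L u') := by
  rw [← gaugeTransform_const_constLift, avgKernel_gaugeTransform_right]

/-- ★ `K̃_β(constLift u^g, constLift u'^h) = K̃_β(constLift u, constLift u')` for ARBITRARY, INDEPENDENT one-site gauge transformations `g, h` of the two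
slots (every one-site gauge transformation is a constant conjugation, `gaugeTransform_one_site_eq_const`): on constant data the averaged kernel is a
function of the PAIR OF `Ad`-ORBITS, not of the LAB pair. [cite: SeilerLNP1982, §3] [cite: Luscher1983, §3] -/
theorem avgKernel_constLift_gaugeTransform (β : ℝ) (g h : Site 3 1 → SU2) (u u' : GaugeConfig 3 1 SU2) :
    avgKernel β (constLift L (gaugeTransform g u)) (constLift L (gaugeTransform h u')) = avgKernel β (constLift L u) (constLift L u') := by
  rw [gaugeTransform_one_site_eq_const g, gaugeTransform_one_site_eq_const h, avgKernel_constLift_conj_left, avgKernel_constLift_conj_right]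

/-! ## §2 The diagonal flip witness -/

/-- A Weyl element: `W = [[0,1],[−1,0]] ∈ SU(2)` conjugates `diag(e^{iθ}, e^{−iθ})` to `diag(e^{−iθ}, e^{iθ})`. [folklore] -/
theorem exists_weylFlip : ∃ W : SU2, ∀ θ : ℝ, W * diagSU2 θ * W⁻¹ = diagSU2 (-θ) := by
  refine ⟨⟨!![0, 1; -1, 0], ?_⟩, fun θ => ?_⟩
  · rw [Matrix.mem_specialUnitaryGroup_iff, Matrix.mem_unitaryGroup_iff]
    refine ⟨?_, ?_⟩
    · ext i j
      fin_cases i <;> fin_cases j <;>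
        simp [Matrix.mul_apply, Fin.sum_univ_two, Matrix.star_eq_conjTranspose, Matrix.conjTranspose_apply]
    · simp [Matrix.det_fin_two_of]
  · rw [mul_inv_eq_iff_eq_mul]
    apply Subtype.ext
    rw [Submonoid.coe_mul, Submonoid.coe_mul, coe_diagSU2, coe_diagSU2]
    ext i j
    fin_cases i <;> fin_cases j <;> simp [Matrix.mul_apply, Fin.sum_univ_two, Complex.ofReal_neg, neg_mul, neg_neg]

omit [NeZero L] in
/-- `Re tr diag(e^{iφ}, e^{−iφ}) = 2 cos φ`. [folklore] -/
theorem re_trace_diagSU2 (φ : ℝ) : (((diagSU2 φ : SU2) : Matrix (Fin 2) (Fin 2) ℂ).trace).re = 2 * Real.cos φ := by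
  rw [coe_diagSU2, Matrix.trace_fin_two_of, Complex.add_re, Complex.exp_ofReal_mul_I_re,
    show -((φ : ℂ) * Complex.I) = ((-φ : ℝ) : ℂ) * Complex.I by push_cast; ring, Complex.exp_ofReal_mul_I_re, Real.cos_neg]
  ring

omit [NeZero L] in
/-- The fundamental representation is the underlying matrix. [folklore] -/
theorem su2Rep_apply (U : SU2) : su2Rep U = (U : Matrix (Fin 2) (Fin 2) ℂ) := rfl

/-- The diagonal time coupling: `Σ_e Re tr(U_e U_e⁻¹) = 2|E|`. [cite: SeilerLNP1982, §3] -/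
theorem timeCoupling_self (U : GaugeConfig 3 L SU2) : timeCoupling su2Rep U U = 2 * (Fintype.card (Edge 3 L) : ℝ) := by
  unfold timeCoupling
  rw [show (2 : ℝ) * (Fintype.card (Edge 3 L) : ℝ) = ∑ _e : Edge 3 L, (2 : ℝ) by
    rw [Finset.sum_const, Finset.card_univ, nsmul_eq_mul, mul_comm]]
  refine Finset.sum_congr rfl fun e _ => ?_
  rw [mul_inv_cancel, map_one, Matrix.trace_one, Fintype.card_fin]
  simp

/-- The time coupling of the flip pair: `Σ_e Re tr(diagSU2 θ · diagSU2(−θ)⁻¹) = 2cos(2θ)·|E|`. [folklore] -/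
theorem timeCoupling_constDiag_flip (θ : ℝ) :
    timeCoupling su2Rep (constLift L fun _ : Edge 3 1 => diagSU2 θ) (constLift L fun _ : Edge 3 1 => diagSU2 (-θ)) =
      2 * Real.cos (2 * θ) * (Fintype.card (Edge 3 L) : ℝ) := by
  unfold timeCoupling
  rw [show 2 * Real.cos (2 * θ) * (Fintype.card (Edge 3 L) : ℝ) = ∑ _e : Edge 3 L, 2 * Real.cos (2 * θ) by
    rw [Finset.sum_const, Finset.card_univ, nsmul_eq_mul, mul_comm]]
  refine Finset.sum_congr rfl fun e _ => ?_
  simp only [constLift_apply]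
  rw [diagSU2_neg, inv_inv, ← diagSU2_add, su2Rep_apply, re_trace_diagSU2, ← two_mul]

omit [NeZero L] in
/-- The flipped constant diagonal configuration is a CONSTANT GAUGE TRANSFORM of the unflipped one. [folklore] -/
theorem constLift_diag_neg_eq_gaugeTransform {W : SU2} (hW : ∀ θ : ℝ, W * diagSU2 θ * W⁻¹ = diagSU2 (-θ)) (θ : ℝ) :
    constLift L (fun _ : Edge 3 1 => diagSU2 (-θ)) = gaugeTransform (fun _ : Site 3 L => W) (constLift L fun _ : Edge 3 1 => diagSU2 θ) := by
  funext e
  show diagSU2 (-θ) = W * diagSU2 θ * W⁻¹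
  exact (hW θ).symm

/-- The one-site flip is a one-site gauge transformation: `u_{−θ} = Ad_W u_θ`. [folklore] -/
theorem oneSite_diag_neg_eq_gaugeTransform {W : SU2} (hW : ∀ θ : ℝ, W * diagSU2 θ * W⁻¹ = diagSU2 (-θ)) (θ : ℝ) :
    (fun _ : Edge 3 1 => diagSU2 (-θ)) = gaugeTransform (fun _ : Site 3 1 => W) (fun _ : Edge 3 1 => diagSU2 θ) := by
  funext e
  show diagSU2 (-θ) = W * diagSU2 θ * W⁻¹
  exact (hW θ).symm

/-- ★ The averaged kernel does not see the flip: `K̃_β(constLift u_θ, constLift u_{−θ}) = K̃_β(constLift u_θ, constLift u_θ)`. [cite: SeilerLNP1982, §3] -/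
theorem avgKernel_constDiag_flip (β θ : ℝ) :
    avgKernel β (constLift L fun _ : Edge 3 1 => diagSU2 θ) (constLift L fun _ : Edge 3 1 => diagSU2 (-θ)) =
      avgKernel β (constLift L fun _ : Edge 3 1 => diagSU2 θ) (constLift L fun _ : Edge 3 1 => diagSU2 θ) := by
  obtain ⟨W, hW⟩ := exists_weylFlip
  rw [constLift_diag_neg_eq_gaugeTransform hW, avgKernel_gaugeTransform_right]

/-- ★ The LAB kernel sees the flip at full kinetic cost (EXACT): `K_β(constLift u_θ, constLift u_{−θ}) = e^{−β|E|(2 − 2cos 2θ)}·K_β(constLift u_θ, constLift u_θ)`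
(the Wilson actions agree by gauge invariance; the time couplings are `2cos(2θ)|E|` and `2|E|`). [cite: SeilerLNP1982, §3] -/
theorem transferKernel_constDiag_flip (β θ : ℝ) :
    transferKernel su2Rep β (constLift L fun _ : Edge 3 1 => diagSU2 θ) (constLift L fun _ : Edge 3 1 => diagSU2 (-θ)) =
      Real.exp (-(β * (2 - 2 * Real.cos (2 * θ)) * Fintype.card (Edge 3 L))) *
        transferKernel su2Rep β (constLift L fun _ : Edge 3 1 => diagSU2 θ) (constLift L fun _ : Edge 3 1 => diagSU2 θ) := by
  obtain ⟨W, hW⟩ := exists_weylFlip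
  have hS : wilsonAction su2Rep (constLift L fun _ : Edge 3 1 => diagSU2 (-θ)) = wilsonAction su2Rep (constLift L fun _ : Edge 3 1 => diagSU2 θ) := by
    rw [constLift_diag_neg_eq_gaugeTransform hW, wilsonAction_gaugeTransform]
  unfold transferKernel
  rw [← Real.exp_add, hS, timeCoupling_constDiag_flip, timeCoupling_self]
  congr 1
  ring

omit [NeZero L] in
/-- Jordan's inequality, squared and doubled: `θ² ≤ 2 − 2cos(2θ) = 4 sin²θ` for `0 ≤ θ ≤ π/2` (uses `π ≤ 4`). [folklore] -/
theorem sq_le_two_sub_two_cos_two_mul {θ : ℝ} (h0 : 0 ≤ θ) (h1 : θ ≤ π / 2) : θ ^ 2 ≤ 2 - 2 * Real.cos (2 * θ) := by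
  have hs : 2 / π * θ ≤ Real.sin θ := Real.mul_le_sin h0 h1
  have hπ : (0 : ℝ) < π := Real.pi_pos
  have hπ4 : π ≤ 4 := Real.pi_le_four
  have h2 : 0 ≤ 2 / π * θ := by positivity
  have hsq : (2 / π * θ) ^ 2 ≤ Real.sin θ ^ 2 := pow_le_pow_left₀ h2 hs 2
  have hπsq : π ^ 2 ≤ 16 := by nlinarith
  have h16 : (1 : ℝ) ≤ 16 / π ^ 2 := by rw [le_div_iff₀ (by positivity)]; linarith
  calc θ ^ 2 ≤ 16 / π ^ 2 * θ ^ 2 := le_mul_of_one_le_left (sq_nonneg θ) h16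
    _ = 4 * (2 / π * θ) ^ 2 := by field_simp; ring
    _ ≤ 4 * Real.sin θ ^ 2 := by linarith
    _ = 2 - 2 * Real.cos (2 * θ) := by rw [Real.cos_two_mul, Real.cos_sq']; ring

omit [NeZero L] in
/-- The constant diagonal configuration is the abelian configuration `V_{(θ,θ,θ)}`. [folklore] -/
theorem constLift_constDiag_eq_abelianCfg (θ : ℝ) : constLift L (fun _ : Edge 3 1 => diagSU2 θ) = abelianCfg L (fun _ : Fin 3 => θ) := rfl

/-- `orbitDist(constLift u_θ) ≤ 3√2·L³·|θ|`. [folklore] -/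
theorem orbitDist_constDiag_le (θ : ℝ) : orbitDist (constLift L fun _ : Edge 3 1 => diagSU2 θ) ≤ 3 * Real.sqrt 2 * (L : ℝ) ^ 3 * |θ| := by
  rw [constLift_constDiag_eq_abelianCfg]
  refine (orbitDist_abelianCfg_le _).trans (le_of_eq ?_)
  simp only [Fin.sum_univ_three]
  ring

/-! ## §3 The flip pair sits inside the core and separates `K̃_β` from `K_β` by any factor -/

/-- ★★ **LAB-far, orbit-identical pairs inside the core.**  For `0 ≤ s < 1/2` and every `ε > 0`, eventually in `β`: there are one-site configurations
`u`, `u' = Ad_g u` with all links within `β^{−s}` of `1` (Frobenius) and `orbitDist(constLift u), orbitDist(constLift u') < β^{−s}` — i.e. BOTH in the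
C4-CORE region at scale `powScale s` — such that the averaged kernel takes its diagonal value on the pair while the LAB kernel is suppressed below
`ε` times its diagonal value.  Witness: `u = u_θ`, `u' = u_{−θ}`, `θ = β^{−s}/(8L³)`, kinetic cost `≥ βθ² = β^{1−2s}/(64L⁶) → ∞`. [folklore] -/
theorem exists_flip_pair {s : ℝ} (hs0 : 0 ≤ s) (hs : s < 1 / 2) {ε : ℝ} (hε : 0 < ε) :
    ∃ β₀ : ℝ, ∀ β : ℝ, β₀ ≤ β → ∃ u u' : GaugeConfig 3 1 SU2,
      (∀ e, frobNorm (((u e : SU2) : Matrix (Fin 2) (Fin 2) ℂ) - 1) < powScale s β) ∧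
      (∀ e, frobNorm (((u' e : SU2) : Matrix (Fin 2) (Fin 2) ℂ) - 1) < powScale s β) ∧
      orbitDist (constLift L u) < powScale s β ∧ orbitDist (constLift L u') < powScale s β ∧
      (∃ g : SU2, u' = gaugeTransform (fun _ : Site 3 1 => g) u) ∧
      avgKernel β (constLift L u) (constLift L u') = avgKernel β (constLift L u) (constLift L u) ∧
      transferKernel su2Rep β (constLift L u) (constLift L u') < ε * transferKernel su2Rep β (constLift L u) (constLift L u) := by
  obtain ⟨W, hW⟩ := exists_weylFlip
  have hq : 0 < 1 - 2 * s := by linarith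
  have hL1 : (1 : ℝ) ≤ (L : ℝ) := by exact_mod_cast Nat.one_le_iff_ne_zero.mpr (NeZero.ne L)
  have hL3 : (1 : ℝ) ≤ (L : ℝ) ^ 3 := one_le_pow₀ hL1
  -- the threshold: `β^{1−2s} ≥ T` with `T/(64 L⁶) > −log ε`
  set T : ℝ := 64 * ((L : ℝ) ^ 3) ^ 2 * max (-Real.log ε) 0 + 1 with hT
  have hT0 : 0 < T := by positivity
  obtain ⟨β₀, hβ₀⟩ := rpow_neg_eventually_le hq (inv_pos.mpr hT0)
  refine ⟨β₀, fun β hβ => ?_⟩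
  obtain ⟨hβ1, hβT⟩ := hβ₀ β hβ
  have hβ0 : 0 < β := by linarith
  -- the scale and the angle
  have hδ : powScale s β = β ^ (-s) := powScale_eq hβ1
  have hδ0 : 0 < powScale s β := powScale_pos s β
  have hδ1 : powScale s β ≤ 1 := by rw [hδ]; exact Real.rpow_le_one_of_one_le_of_nonpos hβ1 (by linarith)
  set θ : ℝ := powScale s β / (8 * (L : ℝ) ^ 3) with hθ
  have hθ0 : 0 < θ := by positivity
  have hθle : θ ≤ powScale s β / 8 := by
    rw [hθ]
    exact div_le_div_of_nonneg_left hδ0.le (by norm_num) (by nlinarith)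
  have hs2 : Real.sqrt 2 < 2 := (Real.sqrt_lt' (by norm_num)).mpr (by norm_num)
  have hs2θ : Real.sqrt 2 * θ < 2 * θ := mul_lt_mul_of_pos_right hs2 hθ0
  have hθ1 : θ ≤ π / 2 := by linarith [Real.pi_gt_three]
  -- β θ² is large
  have hpow : T ≤ β ^ (1 - 2 * s) := by
    have h := hβT
    rw [Real.rpow_neg hβ0.le] at h
    rwa [inv_le_inv₀ (Real.rpow_pos_of_pos hβ0 _) hT0] at h
  have hβθ : β * θ ^ 2 = β ^ (1 - 2 * s) / (64 * ((L : ℝ) ^ 3) ^ 2) := by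
    rw [hθ, hδ, div_pow, mul_pow, ← Real.rpow_natCast (β ^ (-s)) 2, ← Real.rpow_mul hβ0.le, mul_div_assoc']
    congr 1
    · rw [show (1 : ℝ) - 2 * s = 1 + -s * ((2 : ℕ) : ℝ) by push_cast; ring, Real.rpow_add hβ0, Real.rpow_one]
    · norm_num
  have hlog : Real.log ε > -(β * θ ^ 2) := by
    rw [hβθ]
    have h1 : T / (64 * ((L : ℝ) ^ 3) ^ 2) ≤ β ^ (1 - 2 * s) / (64 * ((L : ℝ) ^ 3) ^ 2) := div_le_div_of_nonneg_right hpow (by positivity)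
    have h2 : -Real.log ε < T / (64 * ((L : ℝ) ^ 3) ^ 2) := by
      rw [lt_div_iff₀ (by positivity), hT]
      have := le_max_left (-Real.log ε) 0
      nlinarith
    linarith
  refine ⟨fun _ => diagSU2 θ, fun _ => diagSU2 (-θ), fun _ => ?_, fun _ => ?_, ?_, ?_, ⟨W, oneSite_diag_neg_eq_gaugeTransform hW θ⟩,
    avgKernel_constDiag_flip β θ, ?_⟩
  · refine (frobNorm_diagSU2_sub_one_le θ).trans_lt ?_
    rw [abs_of_pos hθ0]
    linarith
  · refine (frobNorm_diagSU2_sub_one_le (-θ)).trans_lt ?_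
    rw [abs_neg, abs_of_pos hθ0]
    linarith
  · refine (orbitDist_constDiag_le θ).trans_lt ?_
    rw [abs_of_pos hθ0, hθ]
    have : 3 * Real.sqrt 2 * (L : ℝ) ^ 3 * (powScale s β / (8 * (L : ℝ) ^ 3)) = 3 * Real.sqrt 2 / 8 * powScale s β := by
      field_simp
    rw [this]
    nlinarith
  · refine (orbitDist_constDiag_le (-θ)).trans_lt ?_
    rw [abs_neg, abs_of_pos hθ0, hθ]
    have : 3 * Real.sqrt 2 * (L : ℝ) ^ 3 * (powScale s β / (8 * (L : ℝ) ^ 3)) = 3 * Real.sqrt 2 / 8 * powScale s β := by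
      field_simp
    rw [this]
    nlinarith
  · rw [transferKernel_constDiag_flip]
    refine mul_lt_mul_of_pos_right ?_ (transferKernel_pos su2Rep β _ _)
    rw [← Real.exp_log hε, Real.exp_lt_exp]
    have hcard : (1 : ℝ) ≤ Fintype.card (Edge 3 L) := by exact_mod_cast Fintype.card_pos
    have hkin : θ ^ 2 ≤ 2 - 2 * Real.cos (2 * θ) := sq_le_two_sub_two_cos_two_mul hθ0.le hθ1
    have hk0 : 0 ≤ β * (2 - 2 * Real.cos (2 * θ)) := mul_nonneg hβ0.le ((sq_nonneg θ).trans hkin)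
    have : β * θ ^ 2 ≤ β * (2 - 2 * Real.cos (2 * θ)) * Fintype.card (Edge 3 L) :=
      calc β * θ ^ 2 ≤ β * (2 - 2 * Real.cos (2 * θ)) := mul_le_mul_of_nonneg_left hkin hβ0.le
        _ = β * (2 - 2 * Real.cos (2 * θ)) * 1 := (mul_one _).symm
        _ ≤ β * (2 - 2 * Real.cos (2 * θ)) * Fintype.card (Edge 3 L) := mul_le_mul_of_nonneg_left hcard hk0
    linarith

/-! ## §4 No pointwise LAB one-site sandwich for `K̃_β` on the core -/

/-- ★★ **NO LAB one-site slow factor.**  For `0 ≤ s < 1/2` there are NO `η < 1`, eventual `𝒩_β > 0` and positive `Ad`-invariant one-body factors `a_β`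
such that `(1−η)·𝒩_β a_β(u) a_β(u')·K_β(constLift u, constLift u') ≤ K̃_β(constLift u, constLift u') ≤ (1+η)·𝒩_β a_β(u) a_β(u')·K_β(constLift u, constLift u')`
for all one-site `u, u'` in the core (`‖u_k − 1‖_F, ‖u'_k − 1‖_F < β^{−s}`, `orbitDist(constLift u), orbitDist(constLift u') < β^{−s}`).  Proof: at the flip
pair of `exists_flip_pair` the middle terms agree (`K̃_β` is separately `Ad`-invariant, `a_β(u') = a_β(u)`) while the LAB kernels differ by more than
`(1−η)/(1+η)`. [folklore] -/
theorem not_lab_oneSite_sandwich {s : ℝ} (hs0 : 0 ≤ s) (hs : s < 1 / 2)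
    {a : ℝ → GaugeConfig 3 1 SU2 → ℝ} (ha0 : ∀ β u, 0 < a β u)
    (ha : ∀ (β : ℝ) (g : SU2) (u : GaugeConfig 3 1 SU2), a β (gaugeTransform (fun _ : Site 3 1 => g) u) = a β u) :
    ¬ ∃ η : ℝ, η < 1 ∧ ∃ β₀ : ℝ, ∀ β : ℝ, β₀ ≤ β → ∃ 𝒩 : ℝ, 0 < 𝒩 ∧ ∀ u u' : GaugeConfig 3 1 SU2,
        (∀ e, frobNorm (((u e : SU2) : Matrix (Fin 2) (Fin 2) ℂ) - 1) < powScale s β) →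
        (∀ e, frobNorm (((u' e : SU2) : Matrix (Fin 2) (Fin 2) ℂ) - 1) < powScale s β) →
        orbitDist (constLift L u) < powScale s β → orbitDist (constLift L u') < powScale s β →
        (1 - η) * (𝒩 * (a β u * a β u')) * transferKernel su2Rep β (constLift L u) (constLift L u') ≤
            avgKernel β (constLift L u) (constLift L u') ∧
        avgKernel β (constLift L u) (constLift L u') ≤
            (1 + η) * (𝒩 * (a β u * a β u')) * transferKernel su2Rep β (constLift L u) (constLift L u') := by
  rintro ⟨η, hη, β₀, hβ₀⟩
  by_cases hη1 : 1 + η ≤ 0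
  · -- the upper bound is nonpositive at `β₀` itself, on the pair `(1, 1)`
    obtain ⟨𝒩, h𝒩, h⟩ := hβ₀ β₀ le_rfl
    have hδ0 : 0 < powScale s β₀ := powScale_pos s β₀
    have h1 : ∀ e : Edge 3 1, frobNorm ((((fun _ : Edge 3 1 => (1 : SU2)) e : SU2) : Matrix (Fin 2) (Fin 2) ℂ) - 1) < powScale s β₀ := fun e => by
      rw [OneMemClass.coe_one, sub_self, frobNorm_zero]; exact hδ0
    have ho : orbitDist (constLift L fun _ : Edge 3 1 => (1 : SU2)) < powScale s β₀ := by
      rw [show constLift L (fun _ : Edge 3 1 => (1 : SU2)) = fun _ => 1 from rfl, orbitDist_one]; exact hδ0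
    have hup := (h _ _ h1 h1 ho ho).2
    have hpos := avgKernel_pos β₀ (constLift L fun _ : Edge 3 1 => (1 : SU2)) (constLift L fun _ : Edge 3 1 => (1 : SU2))
    have hP : 0 < 𝒩 * (a β₀ (fun _ => 1) * a β₀ (fun _ => 1)) * transferKernel su2Rep β₀ (constLift L fun _ : Edge 3 1 => (1 : SU2))
        (constLift L fun _ : Edge 3 1 => (1 : SU2)) := by
      have := ha0 β₀ (fun _ => 1); have := transferKernel_pos su2Rep β₀ (constLift L fun _ : Edge 3 1 => (1 : SU2)) (constLift L fun _ : Edge 3 1 => (1 : SU2))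
      positivity
    nlinarith
  · have hη1 : 0 < 1 + η := lt_of_not_ge hη1
    have hε : 0 < (1 - η) / (1 + η) := div_pos (by linarith) hη1
    obtain ⟨β₁, hβ₁⟩ := exists_flip_pair (L := L) hs0 hs hε
    obtain ⟨𝒩, h𝒩, h⟩ := hβ₀ (max β₀ β₁) (le_max_left _ _)
    obtain ⟨u, u', hu, hu', ho, ho', ⟨g, hg⟩, hA, hK⟩ := hβ₁ (max β₀ β₁) (le_max_right _ _)
    set β := max β₀ β₁
    have ha' : a β u' = a β u := by rw [hg, ha]
    have hlow := (h u u hu hu ho ho).1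
    have hup := (h u u' hu hu' ho ho').2
    rw [ha', hA] at hup
    have hP : 0 < 𝒩 * (a β u * a β u) := by have := ha0 β u; positivity
    have hKpos := transferKernel_pos su2Rep β (constLift L u) (constLift L u)
    -- `(1−η)·P·K(u,u) ≤ Ã ≤ (1+η)·P·K(u,u') < (1+η)·P·((1−η)/(1+η))·K(u,u) = (1−η)·P·K(u,u)`
    have h3 : (1 + η) * (𝒩 * (a β u * a β u)) * transferKernel su2Rep β (constLift L u) (constLift L u') <
        (1 + η) * (𝒩 * (a β u * a β u)) * ((1 - η) / (1 + η) * transferKernel su2Rep β (constLift L u) (constLift L u)) :=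
      mul_lt_mul_of_pos_left hK (by positivity)
    have h4 : (1 + η) * (𝒩 * (a β u * a β u)) * ((1 - η) / (1 + η) * transferKernel su2Rep β (constLift L u) (constLift L u)) =
        (1 - η) * (𝒩 * (a β u * a β u)) * transferKernel su2Rep β (constLift L u) (constLift L u) := by
      field_simp
    linarith

/-- ★★ **The display (3) at `w = η = 0`, verbatim** (`a ≡ 1`): no `η < 1` and eventual constants `𝒩_β > 0` with
`(1−η)𝒩_β·K_β(constLift u, constLift u') ≤ K̃_β(constLift u, constLift u') ≤ (1+η)𝒩_β·K_β(constLift u, constLift u')` on the core, `0 ≤ s < 1/2`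
(lane A's `s ∈ (1/6, 1/3)` included).  The slow factor of `K̃_β` is the `Ad`-AVERAGED one-site kernel, not `K₁^{L³β}`. [folklore] -/
theorem not_lab_oneSite_sandwich_const {s : ℝ} (hs0 : 0 ≤ s) (hs : s < 1 / 2) :
    ¬ ∃ η : ℝ, η < 1 ∧ ∃ β₀ : ℝ, ∀ β : ℝ, β₀ ≤ β → ∃ 𝒩 : ℝ, 0 < 𝒩 ∧ ∀ u u' : GaugeConfig 3 1 SU2,
        (∀ e, frobNorm (((u e : SU2) : Matrix (Fin 2) (Fin 2) ℂ) - 1) < powScale s β) →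
        (∀ e, frobNorm (((u' e : SU2) : Matrix (Fin 2) (Fin 2) ℂ) - 1) < powScale s β) →
        orbitDist (constLift L u) < powScale s β → orbitDist (constLift L u') < powScale s β →
        (1 - η) * 𝒩 * transferKernel su2Rep β (constLift L u) (constLift L u') ≤ avgKernel β (constLift L u) (constLift L u') ∧
        avgKernel β (constLift L u) (constLift L u') ≤ (1 + η) * 𝒩 * transferKernel su2Rep β (constLift L u) (constLift L u') := by
  rintro ⟨η, hη, β₀, hβ₀⟩
  refine not_lab_oneSite_sandwich (L := L) hs0 hs (a := fun _ _ => (1 : ℝ)) (fun _ _ => one_pos) (fun _ _ _ => rfl) ⟨η, hη, β₀, fun β hβ => ?_⟩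
  obtain ⟨𝒩, h𝒩, h⟩ := hβ₀ β hβ
  refine ⟨𝒩, h𝒩, fun u u' hu hu' ho ho' => ?_⟩
  simpa only [mul_one] using h u u' hu hu' ho ho'

end Summit.QuantumFields.YangMills.Theorems.TwistedTraceScaling.Negative.R32

end
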